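import Literature.MathematicalPhysics.QuantumFieldTheory.Balaban1983to89.B12Ineq349Flat
import Literature.MathematicalPhysics.QuantumFieldTheory.Balaban1983to89.B7Prop5GeneralOperator

/-!
# `Balaban1983to89.B12Ineq349Regular` — [Balaban1987RG1] (3.48)/(3.49) p. 279 HYPOTHESIS-FREE at a GENERAL (52)-regular
background: «B = Q(ηA) = Q(L⁻¹η𝐇_{k+1}) + Q′» and «|Q′| ≤ O(1)L^jη|𝐀| < O(1)α₂L^jη» for the concrete `Λ` of (3.30)/(3.48) and the
concrete composite averaging `Q_j(U₀, ·)` of [Balaban1985Averaging] at a regular background `U₀`, with «Proposition 5 [7]» supplied in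
operator form — PROVED

HONEST FRAMING (cell `lit-balaban`, verbatim): statement-level skeleton of published theorems with citation tags; proofs
where landed; nothing here is a claim about the Yang–Mills mass gap.

CITATION HEADER.  T. Bałaban, *Renormalization group approach to lattice gauge field theories. I*, Commun. Math. Phys.
**109** (1987) 249–301 [Balaban1987RG1] (cell paper B12 = [I]; journal page = PDF page + 248; (3.48)–(3.49) p. 279 read
on the render `b2b-balaban-ref1/pages/1987-cmp109-rg-I-small-field/…-p031-x2.png`);
T. Bałaban, *Averaging operations for lattice gauge theories*, Commun. Math. Phys. **98** (1985) 17–51 [Balaban1985Averaging]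
(= [7] of [I]; Prop. 5 (156) p. 42, (51)–(54) p. 26 — v1.1 locator fix: v1.0 printed «(52) p. 25»; p. 25 carries (46)–(50), r04 CITELOC-AUDIT-g22 §6, re-read on `paper:balaban1985-cmp98-averaging` PDF p. 10 = journal p. 26).  Unit `lit-balaban-r20` gen 5 (fold owner of B12); row B12.Eq3.48-3.49 (supplement:
the δQ/δA input discharged AT A GENERAL REGULAR BACKGROUND) — the twin of `B12Ineq349Flat` (same seat, gen 3: `U₀ = 1`), assembling
`B12QPrime348` (r20: (3.48), (3.49) with the operator input as a hypothesis, `‖δΛ/δ𝐀‖ ≤ 11/8` proved) and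
`B7Prop5GeneralOperator` (p06: Prop. 5 [7] at a general regular background in operator form,
`‖D Q_j(U₀, ·)‖_{sup→sup} ≤ 2dLʲ(1 + θ(Lʲ/Lᵏ)² + C₃Lʲb)`), all BY NAME.

WHAT IS PRINTED.  [I] p. 279 [PDF 31] displays (verbatim up to notation — print's script `A` is written `Λ` here, as in
`B12QPrime348`, to keep it apart from `A`, `𝐀`; v1.2 wording, ref-1 gen 77 record 2026-08-23T03:08Z: v1.0/v1.1 compressed the
two displayed lines into one and labelled the compression «verbatim»): *«From (3.30) we have B = Q(ηA) = Q(L⁻¹η𝐇_{k+1}) + Q′,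
Q′ = ∫₀¹ dt₁ ⟨((δ/δA) Q)(ηΛ(t₁𝐀, L⁻¹𝐇_{k+1})), η⟨((δ/δ𝐀) Λ)(t₁𝐀, L⁻¹𝐇_{k+1}), 𝐀⟩⟩, (3.48) Λ(𝐀, L⁻¹𝐇_{k+1}) =
(1/iη) log exp iη𝐀 exp iL⁻¹η𝐇_{k+1}. The function Q′ satisfies the inequality |Q′| ≤ O(1)L^jη|𝐀| < O(1)α₂L^jη on □₀, (3.49)
with an absolute constant O(1).»* (the (3.49) sentence is exact).  Here `Q` is the averaging operation determining `U_j(□₀)` — a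
composite averaging at the (regular, non-flat) background of §3 — so the general-background form is the one the print uses;
[7] p. 42, Proposition 5, (156): *«|(δ/δA_b)Q_k(U₀, ηA, c)| ≤ 1 + 2C′₁α₀ + C₃|A| < 1 + 2C′₁α₀ + C₃α₁»*.

WHAT THIS FILE PROVES (kernel, 0 sorry, standard axioms; theorems only).  In the regime of `B7Prop5GeneralOperator` (`L ≥ 2`,
`U₀` `G`-valued with `G` `AvgClosed`, (52) `pdev U₀ < α₀L^{−2k}`, the `d`-dependent smallness of `α₀` and of `Lᵏb`, `0 < b`), for finite
sets `S` (fine bonds) and `T` (coarse bonds), `Q = B7Prop5GeneralOperator.covAvgMap L U₀ S T j` (`= Q_j(U₀, ·)` on `𝔸^S → 𝔸^T`),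
`j ≤ k`, `𝐀 ∈ small330 η h` and `(11/8)η(|𝐀(s)| + |h(s)|) ≤ b` bondwise:
**`ineq349_regular`**: `|Q′| ≤ ((11/4)d(1 + θ(Lʲ/Lᵏ)² + C₃Lʲb))·Lʲη|𝐀|` and `< (…)·α₂Lʲη` when `|𝐀| < α₂` — (3.49) with an explicit
`O(1)`, via `B12QPrime348.ineq349_printed` fed with `B7Prop5GeneralOperator.opNorm_fderiv_real_covAvgMap_le` and
`B12QPrime348.norm_fderiv_lam330_le`; `contDiffOn_covAvgMap_polydisc` (`Q_j(U₀, ·)` is `C¹` over `ℝ` on the open polydisc, from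
`B7Prop5GeneralOperator.analyticAt_covAvgMap_apply`); **`eq348_regular`**: the first line of (3.48) itself, HYPOTHESIS-FREE for the
same concrete `Q`, `Λ` (`B12QPrime348.eq348_printed` on the star-shaped open set `small330 ∩ {(11/8)η(|x| + |h|) < b}`);
`qPrime_covAvgMap_one` records that at `U₀ = 1` the `Q′` of this file is the `Q′` of `B12Ineq349Flat` (`covAvgMap_one`).

DIVERGENCES / SCOPE (recorded, not asserted).  `ℤ^d` fine lattice with finitely many live bond variables `S` (the others frozen
at `0`), finitely many coarse bonds `T`; values in the units of a complete normed `ℂ`-algebra with `‖1‖ = 1`; `B`-variables of [7]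
(the `Lʲ` is the scale of the argument `ηΛ`, [7] (150)); the field-level `Λ` is `B12QPrime348.lam330` (bondwise `newPot`), so `Q′`
here is the printed `Q′` of (3.48) for THESE concrete objects; «on □₀» (domains) is not modelled beyond the finite index sets; the
regime's thresholds are the explicit `d`-dependent ones of `B7Prop5General` (p06), not the paper's unnamed «sufficiently small».
-/

namespace Literature.MathematicalPhysics.QuantumFieldTheory.Balaban1983to89.B12Ineq349Regular

open Set
open Literature.MathematicalPhysics.QuantumFieldTheory.Balaban1983to89
open Literature.MathematicalPhysics.QuantumFieldTheory.Balaban1983to89.B12QPrime348 (qPrime lam330 small330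
  smul_mem_small330 norm_fderiv_lam330_le ineq349_printed isOpen_small330 contDiffOn_lam330 lam330_zero_of_mem
  eq348_printed)
open Literature.MathematicalPhysics.QuantumFieldTheory.Balaban1983to89.B12Ineq349Flat (norm_smul_lam330_seg_le
  norm_smul_lam330_le)
open Literature.MathematicalPhysics.QuantumFieldTheory.Balaban1983to89.B7Prop2Explicit (pdev AvgClosed C0 c2')
open Literature.MathematicalPhysics.QuantumFieldTheory.Balaban1983to89.B7Prop3Flat (c3)
open Literature.MathematicalPhysics.QuantumFieldTheory.Balaban1983to89.B7Prop4Flat (isOpen_polydisc)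
open Literature.MathematicalPhysics.QuantumFieldTheory.Balaban1983to89.B7Prop5GeneralLevels (thetaGen C3Gen)
open Literature.MathematicalPhysics.QuantumFieldTheory.Balaban1983to89.B7Prop5FlatOperator (avgMap)
open Literature.MathematicalPhysics.QuantumFieldTheory.Balaban1983to89.B7Prop5GeneralOperator (covAvgMap covAvgMap_one
  opNorm_fderiv_real_covAvgMap_le analyticAt_covAvgMap_apply)

variable {d : ℕ} {𝔸 : Type*} [NormedRing 𝔸] [NormedAlgebra ℂ 𝔸] [CompleteSpace 𝔸] [NormOneClass 𝔸]

variable (L : ℕ) (hL : 2 ≤ L) {G : Subgroup 𝔸ˣ} (hG : AvgClosed d L G) (k : ℕ)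
  (U₀ : B7Prop1Explicit.Site d → Fin d → 𝔸ˣ) (hU₀ : ∀ x κ, U₀ x κ ∈ G) {α₀ : ℝ} (hα : 0 < α₀)
  (hα3 : C0 d * α₀ ≤ 1 / 3) (hα4 : 4 * α₀ ≤ c2' d L) (h52 : pdev U₀ < α₀ * (((L : ℝ) ^ k)⁻¹) ^ 2)
  {b : ℝ} (hb : 0 < b)
  (hsmall : Real.exp (4 * (800 * ((d : ℝ) + 1) ^ 2 * ((d : ℝ) + 4)) * α₀)
    * (1 + 8 * (131072 * ((d : ℝ) + 1) ^ 2) * ((L : ℝ) ^ k * b)) ≤ 2)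
  (hc₃ : 4 * ((L : ℝ) ^ k * b) < c3 d L)
  (h145 : 8 * d * thetaGen d L α₀ * (L : ℝ)⁻¹ ^ 4 ≤ 1)
  (h155 : (2 * (L : ℝ) - 1) * (L : ℝ)⁻¹ ^ 2 + 2 * d * thetaGen d L α₀ * (L : ℝ)⁻¹ ^ 3
    + 1 / 8 * (1 + 2 * d * thetaGen d L α₀ * (L : ℝ)⁻¹ ^ 2 + 2 * d * C3Gen d L * ((L : ℝ) ^ k * b)) * (L : ℝ)⁻¹ ^ 2 ≤ 1)
  (S T : Finset (B7Prop1Explicit.Site d × Fin d))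

include hL hG hU₀ hα hα3 hα4 h52 hb hsmall hc₃ h145 h155 in
/-- **(3.49) AT A GENERAL (52)-REGULAR BACKGROUND, HYPOTHESIS-FREE**: for the concrete `Λ(·, h)` of (3.30)/(3.48) (`lam330 η h`)
and the concrete composite averaging `Q = Q_j(U₀, ·)` of [7] on the finite products `𝔸^S → 𝔸^T`
(`B7Prop5GeneralOperator.covAvgMap L U₀ S T j`, `j ≤ k`, `U₀` in the regime of Proposition 5 [7] at a general regular
background), if `𝐀 ∈ small330 η h` and `(11/8)η(|𝐀(s)| + |h(s)|) ≤ b` on every bond (so that the argument `ηΛ(t𝐀)` stays in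
the closed polydisc of radius `b`, `B12Ineq349Flat.norm_smul_lam330_seg_le`), then
`|Q′| ≤ (2d(1 + θ(Lʲ/Lᵏ)² + C₃Lʲb)·(11/8))·Lʲη|𝐀|`, and `< (…)·α₂Lʲη` when `|𝐀| < α₂` (and the constant is positive) — the
printed «|Q′| ≤ O(1)L^jη|𝐀| < O(1)α₂L^jη» with `O(1) = (11/4)d(1 + θ(Lʲ/Lᵏ)² + C₃Lʲb)`, the inputs being Proposition 5 [7]
in operator form at the background `U₀` (`opNorm_fderiv_real_covAvgMap_le`) and `‖δΛ/δ𝐀‖ ≤ 11/8` (`norm_fderiv_lam330_le`),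
fed to `ineq349_printed` (all BY NAME). [cite: Balaban1987RG1, (3.49) p.279; Balaban1985Averaging, Prop. 5 (156) p.42, (52) p.26] -/
theorem ineq349_regular {j : ℕ} (hj : j ≤ k) {η α₂ : ℝ} (hη : 0 < η) {h A : S → 𝔸} (hA : A ∈ small330 η h)
    (hAb : ∀ s, 11 / 8 * (η * (‖A s‖ + ‖h s‖)) ≤ b) :
    ‖qPrime (covAvgMap L U₀ S T j) (lam330 η h) η A‖ ≤
        (2 * d * (1 + thetaGen d L α₀ * ((L : ℝ) ^ j * ((L : ℝ) ^ k)⁻¹) ^ 2 + C3Gen d L * ((L : ℝ) ^ j * b))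
          * (11 / 8)) * (L : ℝ) ^ j * η * ‖A‖ ∧
      (‖A‖ < α₂ →
        0 < 2 * d * (1 + thetaGen d L α₀ * ((L : ℝ) ^ j * ((L : ℝ) ^ k)⁻¹) ^ 2 + C3Gen d L * ((L : ℝ) ^ j * b))
          * (11 / 8) * (L : ℝ) ^ j * η →
        ‖qPrime (covAvgMap L U₀ S T j) (lam330 η h) η A‖ <
          (2 * d * (1 + thetaGen d L α₀ * ((L : ℝ) ^ j * ((L : ℝ) ^ k)⁻¹) ^ 2 + C3Gen d L * ((L : ℝ) ^ j * b))
            * (11 / 8)) * α₂ * (L : ℝ) ^ j * η) := by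
  refine ineq349_printed
    (C₁ := 2 * d * (1 + thetaGen d L α₀ * ((L : ℝ) ^ j * ((L : ℝ) ^ k)⁻¹) ^ 2 + C3Gen d L * ((L : ℝ) ^ j * b)))
    (C₂ := 11 / 8) (L := (L : ℝ)) (j := j)
    hη.le (fun t ht => ?_) (fun t ht => norm_fderiv_lam330_le hη (smul_mem_small330 hη.le hA ht))
  calc ‖fderiv ℝ (covAvgMap L U₀ S T j) (η • lam330 η h (t • A))‖
      ≤ 2 * d * (L : ℝ) ^ j
          * (1 + thetaGen d L α₀ * ((L : ℝ) ^ j * ((L : ℝ) ^ k)⁻¹) ^ 2 + C3Gen d L * ((L : ℝ) ^ j * b)) :=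
        opNorm_fderiv_real_covAvgMap_le L hL hG k U₀ hU₀ hα hα3 hα4 h52 hb hsmall hc₃ h145 h155 S T
          (fun s => norm_smul_lam330_seg_le hη hA hAb ht s) hj
    _ = 2 * d * (1 + thetaGen d L α₀ * ((L : ℝ) ^ j * ((L : ℝ) ^ k)⁻¹) ^ 2 + C3Gen d L * ((L : ℝ) ^ j * b))
          * (L : ℝ) ^ j := by ring

include hL hG hU₀ hα hα3 hα4 h52 hb hsmall hc₃ in
/-- `Q_j(U₀, ·)` is of class `C¹` over `ℝ` on the open polydisc `{∀ s, ‖y s‖ < b}` in the regime (componentwise analytic: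
`B7Prop5GeneralOperator.analyticAt_covAvgMap_apply`, BY NAME). [cite: Balaban1985Averaging, Prop. 4 p.38] (elementary API;
our proof) -/
theorem contDiffOn_covAvgMap_polydisc {j : ℕ} (hj : j ≤ k) :
    ContDiffOn ℝ 1 (covAvgMap L U₀ S T j) {y : S → 𝔸 | ∀ s, ‖y s‖ < b} :=
  contDiffOn_pi' fun c => fun _ hy =>
    (((analyticAt_covAvgMap_apply L hL hG k U₀ hU₀ hα hα3 hα4 h52 hb hsmall hc₃ S T (fun s => (hy s).le) hj
      c).contDiffAt (n := 1)).restrict_scalars ℝ).contDiffWithinAt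

include hL hG hU₀ hα hα3 hα4 h52 hb hsmall hc₃ in
/-- **(3.48) AT A GENERAL (52)-REGULAR BACKGROUND, HYPOTHESIS-FREE**: «B = Q(ηA) = Q(L⁻¹η𝐇_{k+1}) + Q′» for the concrete `Λ`
of (3.30) (`lam330 η h`, `A = Λ(𝐀, h)`, `h = L⁻¹𝐇_{k+1}`) and the concrete composite averaging `Q = Q_j(U₀, ·)` of [7] on finite
products (`covAvgMap L U₀ S T j`, `j ≤ k`, regime as above): if `𝐀 ∈ small330 η h` and `(11/8)η(|𝐀(s)| + |h(s)|) < b` on every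
bond, then `Q(ηΛ(𝐀, h)) = Q(ηh) + Q′` with the printed integral `Q′ = qPrime Q Λ η 𝐀` — `B12QPrime348.eq348_printed` (BY
NAME) on the star-shaped open set `small330 ∩ {(11/8)η(|x| + |h|) < b}`, which `ηΛ` maps into the polydisc where `Q` is `C¹`
(`contDiffOn_covAvgMap_polydisc`); `Λ(0, h) = h` is `lam330_zero_of_mem`.
[cite: Balaban1987RG1, (3.48) p.279; Balaban1985Averaging, Prop. 4 p.38, (52) p.26] -/
theorem eq348_regular {j : ℕ} (hj : j ≤ k) {η : ℝ} (hη : 0 < η) {h A : S → 𝔸} (hA : A ∈ small330 η h)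
    (hAb : ∀ s, 11 / 8 * (η * (‖A s‖ + ‖h s‖)) < b) :
    covAvgMap L U₀ S T j (η • lam330 η h A) =
      covAvgMap L U₀ S T j (η • h) + qPrime (covAvgMap L U₀ S T j) (lam330 η h) η A := by
  -- the star-shaped open domain of `𝐀`'s and the polydisc of arguments of `Q`
  set s₀ : Set (S → 𝔸) := small330 η h ∩ {x | ∀ s, 11 / 8 * (η * (‖x s‖ + ‖h s‖)) < b} with hs₀
  have hopen' : IsOpen {x : S → 𝔸 | ∀ s, 11 / 8 * (η * (‖x s‖ + ‖h s‖)) < b} := by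
    rw [Set.setOf_forall]
    exact isOpen_iInter_of_finite fun s => isOpen_lt (by fun_prop) continuous_const
  have hs₀o : IsOpen s₀ := (isOpen_small330 η h).inter hopen'
  have hseg : ∀ t ∈ Icc (0 : ℝ) 1, t • A ∈ s₀ := by
    intro t ht
    refine ⟨smul_mem_small330 hη.le hA ht, fun s => ?_⟩
    have htA : ‖(t • A) s‖ ≤ ‖A s‖ := by
      rw [Pi.smul_apply, norm_smul, Real.norm_eq_abs, abs_of_nonneg ht.1]
      exact mul_le_of_le_one_left (norm_nonneg _) ht.2
    have h0 : 0 ≤ ‖h s‖ := norm_nonneg _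
    calc 11 / 8 * (η * (‖(t • A) s‖ + ‖h s‖)) ≤ 11 / 8 * (η * (‖A s‖ + ‖h s‖)) := by gcongr
      _ < b := hAb s
  have hmaps : ∀ x ∈ s₀, η • lam330 η h x ∈ {y : S → 𝔸 | ∀ s, ‖y s‖ < b} := fun x hx s =>
    (norm_smul_lam330_le hη hx.1 s).trans_lt (hx.2 s)
  exact eq348_printed hs₀o (isOpen_polydisc S b) ((contDiffOn_lam330 hη.le h).mono Set.inter_subset_left)
    (contDiffOn_covAvgMap_polydisc L hL hG k U₀ hU₀ hα hα3 hα4 h52 hb hsmall hc₃ S T hj) η A h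
    (lam330_zero_of_mem hη hA) hseg hmaps

omit [NormOneClass 𝔸] in
/-- Consistency with the flat file: at `U₀ = 1` the `Q′` of this file is the `Q′` of `B12Ineq349Flat` (`covAvgMap_one`, BY NAME),
so `ineq349_regular` at the flat background is a (weaker-constant) form of `B12Ineq349Flat.ineq349_flat`.
[cite: Balaban1985Averaging, (127) p.37] (elementary API; our proof) -/
theorem qPrime_covAvgMap_one (j : ℕ) {η : ℝ} (h A : S → 𝔸) :
    qPrime (covAvgMap L (1 : B7Prop1Explicit.Site d → Fin d → 𝔸ˣ) S T j) (lam330 η h) η A =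
      qPrime (avgMap L S T j) (lam330 η h) η A := by
  rw [covAvgMap_one]

end Literature.MathematicalPhysics.QuantumFieldTheory.Balaban1983to89.B12Ineq349Regular
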